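import Mathlib.Analysis.Complex.Polynomial.GaussLucas
import Mathlib.Analysis.Calculus.Deriv.Polynomial
import Mathlib.Analysis.Calculus.Deriv.Inv
import Mathlib.Analysis.Normed.Module.Convex
import HarnessLib

/-!
# A degree-two Walsh coincidence lemma in a disc (via Gauss–Lucas)

Trunk T-CA support (`Literature/Analysis/Complex`), namespace `Literature.Analysis.Complex.PolyaSchur`.
This file is the "circular-domain" input for the sector-operator theorem of
`Literature/Analysis/Complex/SectorOperators.lean` (the operators `(D - ρ)(D - ρ̄)`, `ρ` in the
sector `(Re ρ)² ≥ (d-1)(Im ρ)²`, preserve real-rootedness in degree `≤ d`), which in turn is the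
far-zero step of Kim's corollary on Jensen polynomials (Farmer 2022, §2;
`Literature.Barriers.RiemannHypothesis.Farmer2022_kimCorollary`).

**The lemma** (`coincidence_sum_ne_zero`). Let `ω₁, …, ωₙ` (`n ≥ 2`) lie in a closed disc `K` and
let `r₁, r₂ ∉ K`. Then `∑_{j ≠ k} (ω_j − r₁)(ω_k − r₂) ≠ 0`, i.e. with `S₁ = ∑ ω_j`,
`S₂ = ∑ ω_j²`: `S₁² − S₂ − (n − 1)(r₁ + r₂) S₁ + n(n − 1) r₁ r₂ ≠ 0`.
This is the case "symmetric multi-affine form of degree two" of the Grace–Walsh–Szegő coincidence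
theorem (as stated in Borcea–Brändén, Ann. of Math. 170 (2009), Thm. 11: "Let `f ∈ ℂ[z₁,…,zₙ]` be
symmetric and multi-affine and let `C` be a circular domain containing the points `ζ₁, …, ζₙ`.
Suppose that either the total degree of `f` equals `n` or that `C` is convex (or both). Then there
exists at least one point `ζ ∈ C` such that `f(ζ₁, …, ζₙ) = f(ζ, …, ζ)`."): were the sum zero, the
coincidence theorem would produce `ω ∈ K` with `n(n−1)(ω − r₁)(ω − r₂) = 0`. We give a direct proof
of this special case that needs only the Gauss–Lucas theorem (Mathlib's
`Polynomial.rootSet_derivative_subset_convexHull_rootSet`): after the inversion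
`ν_j = (ω_j − r₁)⁻¹` (which maps `K` onto a closed disc `K'` not containing `0`), the vanishing says
`R''(0) = (n − 1)(r₁ − r₂) R'(0)` for `R = ∏ (X − ν_j)`; the zeros of `R'` lie in `K'` (Gauss–Lucas),
so `R'(0) ≠ 0` and `R''(0)/R'(0) = −∑ τ⁻¹` over the zeros `τ` of `R'`; the points `τ⁻¹` lie in the
disc `K'⁻¹`, hence so does their mean `r₂ − r₁`, i.e. `(r₂ − r₁)⁻¹ ∈ K'`, i.e. `r₂ ∈ K` — a
contradiction.

## Contents (all proved)

* `inv_mem_closedBall_iff` — inversion maps the closed disc `|z − c| ≤ r` (`r < |c|`) onto the closed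
  disc with centre `c̄/(|c|² − r²)` and radius `r/(|c|² − r²)`.
* `hasDerivAt_multiset_sum_inv_sub`, `eval_derivative_derivative_div_eval` — `f''/f = S₁² − S₂` at a
  non-root of a complex polynomial `f`, `S_k = ∑_{roots a} (z − a)^{-k}` (from Mathlib's
  `f'/f = ∑ (z − a)⁻¹`, `Polynomial.Splits.eval_derivative_div_eval_of_ne_zero`, by differentiation).
* `coincidence_aux` (the `ν`-form) and `coincidence_sum_ne_zero` (the lemma above).

## References

* J. Borcea, P. Brändén, *Pólya–Schur master theorems for circular domains and their boundaries*,
  Ann. of Math. 170 (2009), 465–492 = arXiv:math/0607416, Thm. 11 (Grace–Walsh–Szegő coincidence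
  theorem) [BorceaBrandenAnnals2009] (read: §1 Thms. 1–2, §3 Thm. 11).
* M. Marden, *Geometry of polynomials*, 2nd ed., AMS Math. Surveys 3 (1966), Ch. IV (Walsh's
  coincidence theorem, Grace's theorem) and Ch. II (Gauss–Lucas) [Marden1966] (background; not read
  here).
-/

noncomputable section

open Polynomial Complex Metric Set
open scoped ComplexConjugate

namespace Literature.Analysis.Complex.PolyaSchur

/-! ## Inversion of a disc not containing the origin -/

/-- **Inversion of a disc.** For `0 ≤ r < ‖c‖` (so that `0 ∉ closedBall c r`), the point `z⁻¹`
lies in the closed disc with centre `c̄/(‖c‖² − r²)` and radius `r/(‖c‖² − r²)` iff `z` lies in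
`closedBall c r`. (With Lean's `0⁻¹ = 0` both sides are false at `z = 0`.) [folklore] -/
theorem inv_mem_closedBall_iff {c z : ℂ} {r : ℝ} (hr : 0 ≤ r) (hcr : r < ‖c‖) :
    z⁻¹ ∈ closedBall (conj c / ((‖c‖ ^ 2 - r ^ 2 : ℝ) : ℂ)) (r / (‖c‖ ^ 2 - r ^ 2)) ↔
      z ∈ closedBall c r := by
  set A : ℝ := ‖c‖ ^ 2 - r ^ 2 with hA
  have hA0 : 0 < A := by rw [hA]; nlinarith [norm_nonneg c]
  have hc2 : ‖c‖ ^ 2 = c.re ^ 2 + c.im ^ 2 := by rw [Complex.sq_norm, Complex.normSq_apply]; ring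
  rw [mem_closedBall, mem_closedBall, dist_eq_norm, dist_eq_norm]
  -- both sides are equivalent to the polynomial inequality `P ≤ 0`
  set P : ℝ := (z.re ^ 2 + z.im ^ 2) - 2 * (c.re * z.re + c.im * z.im) + (c.re ^ 2 + c.im ^ 2) - r ^ 2
    with hP
  have hR : ‖z - c‖ ≤ r ↔ P ≤ 0 := by
    rw [← sq_le_sq₀ (norm_nonneg _) hr, Complex.sq_norm, Complex.normSq_apply]
    simp only [sub_re, sub_im, hP]
    constructor <;> intro h <;> nlinarith [h]
  rw [hR]
  by_cases hz : z = 0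
  · subst hz
    have h1 : ¬ (P ≤ 0) := by
      rw [hP]; simp only [zero_re, zero_im]; nlinarith [norm_nonneg c]
    have h2 : ¬ (‖(0 : ℂ)⁻¹ - conj c / (A : ℂ)‖ ≤ r / A) := by
      rw [inv_zero, zero_sub, norm_neg, norm_div, Complex.norm_conj, Complex.norm_real,
        Real.norm_of_nonneg hA0.le, div_le_div_iff_of_pos_right hA0]
      exact not_le.2 hcr
    exact iff_of_false h2 h1
  · have hz' : 0 < ‖z‖ := norm_pos_iff.2 hz
    have hAz : (A : ℂ) * z ≠ 0 := mul_ne_zero (by exact_mod_cast hA0.ne') hz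
    have hA' : (A : ℂ) ≠ 0 := by exact_mod_cast hA0.ne'
    have hid : z⁻¹ - conj c / (A : ℂ) = ((A : ℂ) - conj c * z) / ((A : ℂ) * z) := by
      field_simp
    rw [hid, norm_div, norm_mul, Complex.norm_real, Real.norm_of_nonneg hA0.le,
      div_le_div_iff₀ (mul_pos hA0 hz') hA0]
    rw [show ‖(A : ℂ) - conj c * z‖ * A ≤ r * (A * ‖z‖) ↔ ‖(A : ℂ) - conj c * z‖ ≤ r * ‖z‖ by
      rw [show r * (A * ‖z‖) = r * ‖z‖ * A by ring]
      exact mul_le_mul_iff_of_pos_right hA0]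
    rw [← sq_le_sq₀ (norm_nonneg _) (by positivity), mul_pow, Complex.sq_norm, Complex.sq_norm,
      Complex.normSq_apply, Complex.normSq_apply]
    have hre : ((A : ℂ) - conj c * z).re = A - (c.re * z.re + c.im * z.im) := by
      simp [Complex.mul_re]
    have him : ((A : ℂ) - conj c * z).im = -(c.re * z.im - c.im * z.re) := by
      simp [Complex.mul_im]; ring
    rw [hre, him]
    have hAdef : A = c.re ^ 2 + c.im ^ 2 - r ^ 2 := by rw [hA, hc2]
    constructor
    · intro h
      -- `A² - 2At + (|c|² |z|²) ≤ r² |z|²` gives `A (A - 2t + |z|²) ≤ 0`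
      have key : A * P ≤ 0 := by rw [hP]; nlinarith [h, hAdef]
      nlinarith [key, hA0]
    · intro h
      have key : A * P ≤ 0 := mul_nonpos_of_nonneg_of_nonpos hA0.le h
      nlinarith [key, hAdef, hP]

/-! ## The second logarithmic derivative of a polynomial -/

/-- Derivative of `w ↦ ∑_{a ∈ s} (w − a)⁻¹` off `s`: `−∑ (z − a)⁻²`. [folklore] -/
theorem hasDerivAt_multiset_sum_inv_sub (s : Multiset ℂ) {z : ℂ} (hz : ∀ a ∈ s, z ≠ a) :
    HasDerivAt (fun w : ℂ => (s.map fun a => (w - a)⁻¹).sum)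
      (-(s.map fun a => ((z - a) ^ 2)⁻¹).sum) z := by
  induction s using Multiset.induction_on with
  | empty => simpa using hasDerivAt_const z (0 : ℂ)
  | cons a s ih =>
    have ha : z - a ≠ 0 := sub_ne_zero.2 (hz a (Multiset.mem_cons_self a s))
    have h1 : HasDerivAt (fun w : ℂ => (w - a)⁻¹) (-(1 : ℂ) / (z - a) ^ 2) z :=
      ((hasDerivAt_id z).sub_const a).inv ha
    have h2 : HasDerivAt (fun w : ℂ => (w - a)⁻¹ + (s.map fun b => (w - b)⁻¹).sum)
        (-(1 : ℂ) / (z - a) ^ 2 + -(s.map fun b => ((z - b) ^ 2)⁻¹).sum) z :=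
      h1.add (ih fun b hb => hz b (Multiset.mem_cons_of_mem hb))
    simp only [Multiset.map_cons, Multiset.sum_cons]
    convert h2 using 1
    rw [neg_add, neg_div, one_div]

/-- A root `a` of `f` is not a point where `f ≠ 0`. [folklore] -/
theorem ne_of_mem_roots_of_eval_ne_zero {f : ℂ[X]} {z : ℂ} (hz : f.eval z ≠ 0) {a : ℂ}
    (ha : a ∈ f.roots) : z ≠ a := by
  rintro rfl
  exact hz ((mem_roots'.1 ha).2)

/-- **`f''/f = S₁² − S₂`.** For a complex polynomial `f` and `z` with `f(z) ≠ 0`: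
`f''(z)/f(z) = (∑_a (z − a)⁻¹)² − ∑_a (z − a)⁻²`, the sums over the roots of `f` with
multiplicity (differentiate `f'/f = ∑ (z − a)⁻¹` and use `f''/f = (f'/f)' + (f'/f)²`). [folklore] -/
theorem eval_derivative_derivative_div_eval {f : ℂ[X]} {z : ℂ} (hz : f.eval z ≠ 0) :
    f.derivative.derivative.eval z / f.eval z =
      (f.roots.map fun a => (z - a)⁻¹).sum ^ 2 - (f.roots.map fun a => ((z - a) ^ 2)⁻¹).sum := by
  have hfs : f.Splits := IsAlgClosed.splits f
  -- `f'/f` agrees with `∑ (w - a)⁻¹` near `z`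
  have hopen : IsOpen {w : ℂ | f.eval w ≠ 0} := isOpen_ne_fun f.continuous continuous_const
  have hev : (fun w => f.derivative.eval w / f.eval w) =ᶠ[nhds z]
      fun w => (f.roots.map fun a => (w - a)⁻¹).sum := by
    filter_upwards [hopen.mem_nhds hz] with w hw
    rw [hfs.eval_derivative_div_eval_of_ne_zero hw]
    simp only [one_div]
  have hd1 : HasDerivAt (fun w => f.derivative.eval w / f.eval w)
      ((f.derivative.derivative.eval z * f.eval z - f.derivative.eval z * f.derivative.eval z) /
        f.eval z ^ 2) z :=
    (f.derivative.hasDerivAt z).div (f.hasDerivAt z) hz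
  have hd2 := hasDerivAt_multiset_sum_inv_sub f.roots
    (fun a ha => ne_of_mem_roots_of_eval_ne_zero hz ha)
  have heq := hev.deriv_eq
  rw [hd1.deriv, hd2.deriv] at heq
  have hS1 : f.derivative.eval z / f.eval z = (f.roots.map fun a => (z - a)⁻¹).sum := by
    rw [hfs.eval_derivative_div_eval_of_ne_zero hz]; simp only [one_div]
  rw [← hS1]
  have : f.derivative.derivative.eval z / f.eval z =
      (f.derivative.derivative.eval z * f.eval z - f.derivative.eval z * f.derivative.eval z) /
        f.eval z ^ 2 + (f.derivative.eval z / f.eval z) ^ 2 := by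
    field_simp
    ring
  rw [this, heq]
  ring

/-! ## The coincidence lemma -/

/-- **The `ν`-form.** Let `ν₁, …, νₙ` (`n ≥ 2`, a multiset `s`) lie in a closed disc
`closedBall c r` with `r < ‖c‖` (so `0` is outside), `R = ∏ (X − ν_j)`, and suppose
`R''(0) = (n − 1) δ R'(0)`. Then `δ ≠ 0` and `(−δ)⁻¹ ∈ closedBall c r`. (Gauss–Lucas: the zeros `τ`
of `R'` lie in the disc, so `R'(0) ≠ 0` and `−δ` is the mean of the `τ⁻¹`, which lie in the inverted
disc.) [cite: BorceaBrandenAnnals2009, Thm. 11 (special case)] -/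
theorem coincidence_aux (s : Multiset ℂ) (hs : 2 ≤ Multiset.card s) {c : ℂ} {r : ℝ} (hr : 0 ≤ r)
    (hcr : r < ‖c‖) (hmem : ∀ ν ∈ s, ν ∈ closedBall c r) (δ : ℂ)
    (hcond : (s.map fun ν => X - C ν).prod.derivative.derivative.eval 0 =
      ((Multiset.card s - 1 : ℕ) : ℂ) * δ * (s.map fun ν => X - C ν).prod.derivative.eval 0) :
    δ ≠ 0 ∧ (-δ)⁻¹ ∈ closedBall c r := by
  classical
  set R : ℂ[X] := (s.map fun ν => X - C ν).prod with hRdef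
  set n : ℕ := Multiset.card s with hn
  have hRmonic : R.Monic := monic_multiset_prod_of_monic _ _ fun ν _ => monic_X_sub_C ν
  have hR0 : R ≠ 0 := hRmonic.ne_zero
  have hRdeg : R.natDegree = n := by
    rw [hRdef, natDegree_multiset_prod_X_sub_C_eq_card]
  have hRroots : R.roots = s := roots_multiset_prod_X_sub_C s
  set R' : ℂ[X] := R.derivative with hR'def
  have hR'deg : R'.natDegree = n - 1 := by rw [hR'def, natDegree_derivative, hRdeg]
  have hR'0 : R' ≠ 0 := by
    rw [hR'def, Ne, derivative_eq_zero, hRdeg]; omega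
  -- the disc is convex and contains the roots of `R`, hence (Gauss–Lucas) those of `R'`
  have hsub : R'.rootSet ℂ ⊆ closedBall c r := by
    have hdegpos : 0 < R.degree := by
      rw [degree_eq_natDegree hR0, hRdeg]; exact_mod_cast (by omega : 0 < n)
    refine (rootSet_derivative_subset_convexHull_rootSet hdegpos).trans
      (convexHull_min (fun a ha => ?_) (convex_closedBall c r))
    rw [mem_rootSet] at ha
    have : a ∈ R.roots := (mem_roots hR0).2 (by simpa using ha.2)
    rw [hRroots] at this
    exact hmem a this
  have hroot' : ∀ τ ∈ R'.roots, τ ∈ closedBall c r := fun τ hτ =>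
    hsub (by rw [mem_rootSet]; exact ⟨hR'0, by simpa using (mem_roots hR'0).1 hτ⟩)
  have h0notin : (0 : ℂ) ∉ closedBall c r := by
    rw [mem_closedBall, dist_eq_norm, zero_sub, norm_neg]; exact not_le.2 hcr
  have hR'eval : R'.eval 0 ≠ 0 := fun h =>
    h0notin (hsub (by rw [mem_rootSet]; exact ⟨hR'0, by simpa using h⟩))
  -- `R''(0)/R'(0) = Σ_τ 1/(0 - τ)`
  have hsplit' : R'.Splits := IsAlgClosed.splits R'
  have hlog := hsplit'.eval_derivative_div_eval_of_ne_zero hR'eval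
  have hcard' : Multiset.card R'.roots = n - 1 := by
    rw [← hsplit'.natDegree_eq_card_roots, hR'deg]
  have hn1 : ((n - 1 : ℕ) : ℂ) ≠ 0 := by exact_mod_cast (by omega : n - 1 ≠ 0)
  -- hence `-δ` is the mean of the `τ⁻¹`
  have hδ : -δ = ((n - 1 : ℕ) : ℂ)⁻¹ * (R'.roots.map fun τ => τ⁻¹).sum := by
    have h1 : R'.derivative.eval 0 / R'.eval 0 = ((n - 1 : ℕ) : ℂ) * δ := by
      rw [div_eq_iff hR'eval]; exact hcond
    rw [h1] at hlog
    have h2 : (R'.roots.map fun τ => 1 / (0 - τ)).sum = -(R'.roots.map fun τ => τ⁻¹).sum := by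
      rw [← Multiset.sum_map_neg]
      congr 1
      refine Multiset.map_congr rfl fun τ _ => ?_
      rw [zero_sub, one_div, inv_neg]
    rw [h2] at hlog
    rw [eq_inv_mul_iff_mul_eq₀ hn1, mul_neg, hlog, neg_neg]
  -- the inverted disc
  set A : ℝ := ‖c‖ ^ 2 - r ^ 2 with hA
  have hA0 : 0 < A := by rw [hA]; nlinarith [norm_nonneg c]
  set c'' : ℂ := conj c / (A : ℂ) with hc''
  set r'' : ℝ := r / A with hr''
  have hmem'' : ∀ τ ∈ R'.roots, ‖τ⁻¹ - c''‖ ≤ r'' := fun τ hτ => by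
    have := (inv_mem_closedBall_iff (z := τ) hr hcr).2 (hroot' τ hτ)
    rwa [mem_closedBall, dist_eq_norm] at this
  have hmean : ‖-δ - c''‖ ≤ r'' := by
    have hn1' : (0 : ℝ) < ((n - 1 : ℕ) : ℝ) := by exact_mod_cast (by omega : 0 < n - 1)
    have hrepr : -δ - c'' = ((n - 1 : ℕ) : ℂ)⁻¹ * (R'.roots.map fun τ => τ⁻¹ - c'').sum := by
      rw [hδ, Multiset.sum_map_sub, Multiset.map_const', Multiset.sum_replicate, hcard',
        nsmul_eq_mul, mul_sub, ← mul_assoc, inv_mul_cancel₀ hn1, one_mul]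
    rw [hrepr, norm_mul, norm_inv, Complex.norm_natCast]
    calc ((n - 1 : ℕ) : ℝ)⁻¹ * ‖(R'.roots.map fun τ => τ⁻¹ - c'').sum‖
        ≤ ((n - 1 : ℕ) : ℝ)⁻¹ * (R'.roots.map fun τ => r'').sum := by
          gcongr
          refine (norm_multiset_sum_le _).trans ?_
          rw [Multiset.map_map]
          exact Multiset.sum_map_le_sum_map _ _ fun τ hτ => hmem'' τ hτ
      _ = r'' := by
          rw [Multiset.map_const', Multiset.sum_replicate, hcard', nsmul_eq_mul, ← mul_assoc,
            inv_mul_cancel₀ hn1'.ne', one_mul]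
  have hδ0 : δ ≠ 0 := by
    rintro rfl
    rw [neg_zero, zero_sub, norm_neg, hc'', norm_div, Complex.norm_conj, Complex.norm_real,
      Real.norm_of_nonneg hA0.le, hr'', div_le_div_iff_of_pos_right hA0] at hmean
    exact not_le.2 hcr hmean
  refine ⟨hδ0, ?_⟩
  have h := (inv_mem_closedBall_iff (z := (-δ)⁻¹) hr hcr).1
  rw [inv_inv, mem_closedBall, dist_eq_norm] at h
  exact h hmean

/-- **Degree-two coincidence lemma in a disc.** If `ω₁, …, ωₙ` (`n ≥ 2`, a multiset `W`) lie in a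
closed disc `K` and `r₁, r₂ ∉ K`, then with `S₁ = ∑ ω_j`, `S₂ = ∑ ω_j²`:
`S₁² − S₂ − (n − 1)(r₁ + r₂) S₁ + n(n − 1) r₁ r₂ = ∑_{j ≠ k} (ω_j − r₁)(ω_k − r₂) ≠ 0`
(Walsh's coincidence theorem for the symmetric bi-affine form `∑_{j≠k}(ω_j − r₁)(ω_k − r₂)`;
proved here via `coincidence_aux` after the inversion `ν_j = (ω_j − r₁)⁻¹`).
[cite: BorceaBrandenAnnals2009, Thm. 11 (special case)] -/
theorem coincidence_sum_ne_zero (W : Multiset ℂ) (hW : 2 ≤ Multiset.card W) {c₀ : ℂ} {r₀ : ℝ}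
    (hr₀ : 0 ≤ r₀) (hmem : ∀ ω ∈ W, ω ∈ closedBall c₀ r₀) {r₁ r₂ : ℂ}
    (h₁ : r₁ ∉ closedBall c₀ r₀) (h₂ : r₂ ∉ closedBall c₀ r₀) :
    W.sum ^ 2 - (W.map fun ω => ω ^ 2).sum
        - ((Multiset.card W - 1 : ℕ) : ℂ) * (r₁ + r₂) * W.sum
        + (Multiset.card W : ℂ) * ((Multiset.card W - 1 : ℕ) : ℂ) * (r₁ * r₂) ≠ 0 := by
  classical
  intro hQ
  set n : ℕ := Multiset.card W with hn
  -- the inversion `ν = (ω - r₁)⁻¹` and the disc it maps `K - r₁` onto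
  set c : ℂ := c₀ - r₁ with hc
  have hcr : r₀ < ‖c‖ := by
    rw [mem_closedBall, dist_eq_norm, not_le] at h₁
    rwa [hc, ← norm_neg, neg_sub]
  set A : ℝ := ‖c‖ ^ 2 - r₀ ^ 2 with hA
  have hA0 : 0 < A := by rw [hA]; nlinarith [norm_nonneg c]
  set c' : ℂ := conj c / (A : ℂ) with hc'
  set r' : ℝ := r₀ / A with hr'
  have hr'0 : 0 ≤ r' := div_nonneg hr₀ hA0.le
  have hc'r' : r' < ‖c'‖ := by
    rw [hc', hr', norm_div, Complex.norm_conj, Complex.norm_real, Real.norm_of_nonneg hA0.le]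
    exact div_lt_div_of_pos_right hcr hA0
  set s : Multiset ℂ := W.map fun ω => (ω - r₁)⁻¹ with hs
  have hcard : Multiset.card s = n := by rw [hs, Multiset.card_map]
  have hων : ∀ ω ∈ W, ω - r₁ ≠ 0 := fun ω hω h => h₁ (by rw [sub_eq_zero] at h; exact h ▸ hmem ω hω)
  have hsmem : ∀ ν ∈ s, ν ∈ closedBall c' r' := by
    intro ν hν
    obtain ⟨ω, hω, rfl⟩ := Multiset.mem_map.1 hν
    refine (inv_mem_closedBall_iff hr₀ hcr).2 ?_
    have := hmem ω hω
    rw [mem_closedBall, dist_eq_norm] at this ⊢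
    rwa [hc, sub_sub_sub_cancel_right]
  have hs0 : ∀ ν ∈ s, ν ≠ 0 := by
    intro ν hν
    obtain ⟨ω, hω, rfl⟩ := Multiset.mem_map.1 hν
    exact inv_ne_zero (hων ω hω)
  -- `R = ∏ (X - ν)` and its logarithmic derivatives at `0`
  set R : ℂ[X] := (s.map fun ν => X - C ν).prod with hRdef
  have hRroots : R.roots = s := roots_multiset_prod_X_sub_C s
  have hR0eval : R.eval 0 ≠ 0 := by
    rw [hRdef, eval_multiset_prod, Multiset.map_map]
    refine Multiset.prod_ne_zero fun h => ?_
    obtain ⟨ν, hν, hν0⟩ := Multiset.mem_map.1 h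
    simp only [Function.comp_apply, eval_sub, eval_X, eval_C, zero_sub, neg_eq_zero] at hν0
    exact hs0 ν hν hν0
  have hL1 : R.derivative.eval 0 / R.eval 0 = -(W.sum - (n : ℂ) * r₁) := by
    rw [(IsAlgClosed.splits R).eval_derivative_div_eval_of_ne_zero hR0eval, hRroots, hs,
      Multiset.map_map]
    have : (fun ω : ℂ => 1 / (0 - (ω - r₁)⁻¹)) = fun ω => -(ω - r₁) := by
      funext ω; rw [zero_sub, one_div, inv_neg, inv_inv]
    rw [show ((fun x : ℂ => 1 / (0 - x)) ∘ fun ω => (ω - r₁)⁻¹) = fun ω => -(ω - r₁) from this,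
      Multiset.sum_map_neg, Multiset.sum_map_sub, Multiset.map_const', Multiset.sum_replicate,
      Multiset.map_id', nsmul_eq_mul]
  have hL2 : R.derivative.derivative.eval 0 / R.eval 0 =
      (W.sum - (n : ℂ) * r₁) ^ 2 - ((W.map fun ω => ω ^ 2).sum - 2 * r₁ * W.sum + (n : ℂ) * r₁ ^ 2) := by
    rw [eval_derivative_derivative_div_eval hR0eval, hRroots, hs, Multiset.map_map, Multiset.map_map]
    have e1 : ((fun a : ℂ => (0 - a)⁻¹) ∘ fun ω => (ω - r₁)⁻¹) = fun ω => -(ω - r₁) := by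
      funext ω; simp
    have e2 : ((fun a : ℂ => ((0 - a) ^ 2)⁻¹) ∘ fun ω => (ω - r₁)⁻¹) = fun ω => (ω - r₁) ^ 2 := by
      funext ω; simp
    rw [e1, e2, Multiset.sum_map_neg, Multiset.sum_map_sub, Multiset.map_const',
      Multiset.sum_replicate, Multiset.map_id', nsmul_eq_mul, neg_sq]
    congr 1
    have e3 : (fun ω : ℂ => (ω - r₁) ^ 2) = fun ω => ω ^ 2 - 2 * r₁ * ω + r₁ ^ 2 := by
      funext ω; ring
    rw [e3, Multiset.sum_map_add, Multiset.sum_map_sub, Multiset.sum_map_mul_left,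
      Multiset.map_const', Multiset.sum_replicate, Multiset.map_id', nsmul_eq_mul]
  -- the vanishing of `Q` is exactly `R''(0) = (n-1)(r₁ - r₂) R'(0)`
  have hcond : R.derivative.derivative.eval 0 =
      ((Multiset.card s - 1 : ℕ) : ℂ) * (r₁ - r₂) * R.derivative.eval 0 := by
    rw [hcard]
    have h1 : R.derivative.derivative.eval 0 = R.eval 0 * ((W.sum - (n : ℂ) * r₁) ^ 2 -
        ((W.map fun ω => ω ^ 2).sum - 2 * r₁ * W.sum + (n : ℂ) * r₁ ^ 2)) := by
      rw [← hL2, mul_div_cancel₀ _ hR0eval]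
    have h2 : R.derivative.eval 0 = R.eval 0 * -(W.sum - (n : ℂ) * r₁) := by
      rw [← hL1, mul_div_cancel₀ _ hR0eval]
    rw [h1, h2]
    have hn2 : ((n - 1 : ℕ) : ℂ) = (n : ℂ) - 1 := by
      rw [Nat.cast_sub (by omega : 1 ≤ n), Nat.cast_one]
    rw [hn2] at hQ ⊢
    linear_combination R.eval 0 * hQ
  obtain ⟨hδ, hinv⟩ := coincidence_aux s (by rw [hcard]; exact hW) hr'0 hc'r' hsmem (r₁ - r₂) hcond
  -- `(-(r₁ - r₂))⁻¹ = (r₂ - r₁)⁻¹ ∈ K'` means `r₂ - r₁ ∈ K - r₁`, i.e. `r₂ ∈ K`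
  have h := (inv_mem_closedBall_iff (z := r₂ - r₁) hr₀ hcr).1
  rw [neg_sub] at hinv
  have hr₂ : r₂ - r₁ ∈ closedBall c r₀ := h hinv
  apply h₂
  rw [mem_closedBall, dist_eq_norm] at hr₂ ⊢
  rwa [hc, sub_sub_sub_cancel_right] at hr₂

end Literature.Analysis.Complex.PolyaSchur
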